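import Summits.QuantumFields.YangMills.Theorems.TypicalExteriorCeilingsAnnealedBoundaryLawWickSquare
import Summits.QuantumFields.YangMills.Theorems.BalabanLadderUVSeamRecGaussianCalibrationWeight
import Summits.QuantumFields.YangMills.Theorems.BalabanLadderUVSeamRecGaussianCalibrationMarkov
import Literature.MathematicalPhysics.QuantumFieldTheory.CurvatureGaussianField
import HarnessLib

/-!
# Route `TypicalExteriorCeilings`, deciding crux `AnnealedBoundaryLaw` (stmt-QuantumFields-25891; split V = `VarianceBoundaryLaw`
# stmt-25920 / M = `MomentComparability` stmt-25921): BC5 FIRST RUNG α — the lattice-Gaussian (free-Maxwell) instance, `κ = 1` (part 2/2)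

Helper file (`--supports stmt-QuantumFields-25891`) of the tribunal-w (bc5-witness) seat `ym-tec-bc5w-1` (g0); theorems only, no definitions,
no sorry, standard axioms.

HONEST FRAMING (read first).  NOTHING here proves or claims the Yang–Mills mass gap, the route's leaf
`InfiniteVolumeContinuum.HypercubicOSDataFromInfiniteVolume` (stmt-QuantumFields-19868), `BalabanLadder.NT`, or any of the route's cruxes K1 / V / M:
those are statements about the SU(2) Wilson state on the torus, under LIVE sub-onset floors.  This file DECIDES their analogues in the one model in
which the exterior kernel is explicit — the massless lattice free field `ν` of `ℤ⁴` (`IsDiscreteGFF ν (coordProc 4)`; the abelian / free-Maxwell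
caricature of the plaquette field).  DICTIONARY (the same as the tree's `UVSeamRec` Gaussian-calibration series, files
`BalabanLadderUVSeamRecGaussianCalibration{Law,Markov,Sharp,Weight}`): plaquette `plane_q(x)` ↦ squared lattice gradient `(φ_{x+e_j} − φ_x)²`;
femto kernel `kerE(V)` = expectation given the configuration `V` OFF the cube of side `2R+3` centred at `x` ↦ the conditional expectation
`ν[ · | σ(φ_w : w ∉ Λ)]`, `Λ = x + sbox(R+1)` (side `2R+3`); torus mean `torusE` ↦ `∫ · dν`.  The crux variable
`Ȳ = kerE(plane)(V) − torusE(plane)` becomes `Z = ν[(∇_jφ(x))² | exterior] − ∫(∇_jφ(x))² dν`, and by the tree's free-field kernel identity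
(`condExp_gradient_sq_exterior`, Friedli–Velenik Thm. 8.21) `Z = a² − ∫a² dν` a.e., where `a = ∇_j(φ − ψ^Λ)(x)` is the centre gradient of the
HARMONIC EXTENSION of the exterior field — a centred Gaussian (boundary linear statistic) of variance `s = ∫a² dν`, with the two-sided law
`c/R⁴ ≤ s ≤ v/R⁴` (tree: `gff_integral_centreGradient_sq_le`, `…_ge`).  Hence `Z` is a centred Gaussian SQUARE (second Wiener chaos) and everything
is one-dimensional Gaussian calculus:

* V (free field) `gff_varianceBoundaryLaw(_condExp)`: `∫ |Z|² dν = 2s² ≤ (2v/R⁴)²` for all `R ≥ 1`, `x`, `j` — and the rate is ATTAINED: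
  `(c/R⁴)² ≤ ∫|Z|² dν` for `R ≥ R₀` (`gff_varianceBoundaryLaw_sharp`); the `R⁻⁴`-per-plaquette law of V is the free-field truth, not slack.
* M (free field) `gff_momentComparability(_condExp)`: `(∫|Z|^p dν)² ≤ (6·p¹)^{2p} (∫|Z|² dν)^p` for all `p ≥ 1` — moment comparability with
  `κ = 1` (order-2 chaos: `‖Z‖_p ≲ p‖Z‖₂`; here by explicit Gaussian moments `E a^{2p} = s^p (2p−1)‼ ≤ (2ps)^p`; `κ = 1` is also optimal in this
  model since `(2p−1)‼^{1/p} ≍ p`, not formalised here).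
* K1 (free field) `gff_annealedBoundaryLaw(_condExp)`: `∫|Z|^p dν ≤ (8v·p/R⁴)^p`, `κ = 1` — the glue V ∧ M ⇒ K1 run in the model.
* non-vacuity: the lattice GFF of `ℤ⁴` exists on the canonical space (`exists_isDiscreteGFF_four`, Kolmogorov extension of the tree).

WHY THE FLOORS PREFIX IS DROPPED (and why that is the right rung).  V/M/K1 carry the route's live-floor premise (`ε ≤ Q2`, `ε ≤ |Q3|` on a window
of scales).  `Q3` is a TRUNCATED three-point function, identically `0` in any Gaussian model, so the literal Gaussian instance of "floors ⇒ law" is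
vacuous; the rung is the floors-free CONCLUSION, which is STRONGER (unconditional in `R ≥ 1`, `x`, `j`, `p ≥ 1`; no sub-onset window, no `β₁`).
What the rung deliberately does NOT contain: anything about SU(2), large fields, or the onset scale — the non-Gaussian content of the crux.

Contents (part 2/2; part 1 = `TypicalExteriorCeilingsAnnealedBoundaryLawWickSquare`: the one-dimensional Wick-square calculus and its transport
to any centred Gaussian): §3 the GFF theorems for `a = ∇_j(φ − ψ^Λ)(x)`; §4 the same in conditional-expectation (= `kerE`) form; §5 existence of
the GFF of `ℤ⁴`; §6 the rung in the cruxes' literal functional shape `C·p^κ`, `κ = 1` (`rung_varianceBoundaryLaw_freeField`,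
`rung_momentComparability_freeField`, `rung_annealedBoundaryLaw_freeField`).
References: S. Janson, *Gaussian Hilbert Spaces* (1997), Rem. 1.30, Thm. 5.10 [Janson1997]; S. Friedli, Y. Velenik, *Statistical Mechanics of
Lattice Systems* (2017), Ch. 8, Thm. 8.21 / Prop. 8.7 [FriedliVelenik2017]; O. Kallenberg, *Foundations of Modern Probability* (2002), Lemma 13.1
[Kallenberg2002].
-/

set_option autoImplicit false

noncomputable section

open MeasureTheory ProbabilityTheory Finset
open scoped NNReal
open Literature.Probability.LatticeModels
open Literature.Probability.Distributions
open Literature.MathematicalPhysics.QuantumFieldTheory.LatticeForm (e)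
open Summit.QuantumFields.YangMills.Theorems.WeakCouplingRates.HarmonicInterior
open Summit.QuantumFields.YangMills.Cruxes.UVSeamRec.GaussianCalibration

namespace Summit.QuantumFields.YangMills.Cruxes.AnnealedBoundaryLaw.GaussianRung

/-! ## §3 The lattice free field of `ℤ⁴`: V, M, K1 for the exterior response `a² − ∫a²`, `a = ∇_j(φ − ψ^Λ)(x)` -/

section GFF

variable {ν : Measure (Site 4 → ℝ)}

/-- The centre gradient of the harmonic extension of the exterior field, `a = ∇_j(φ − ψ^Λ)(x)`, `Λ = x + sbox(R+1)`, is a CENTRED GAUSSIAN under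
the GFF (a boundary linear statistic `Σ_w (H_Λ(x+e_j,w) − H_Λ(x,w)) φ_w`). [cite: FriedliVelenik2017, Ch. 8 Prop. 8.7] -/
theorem hasGaussianLaw_centreGradient (hν : IsDiscreteGFF ν (coordProc 4)) (R : ℕ) (j : Fin 4) (x : Site 4) :
    HasGaussianLaw (fun φ : Site 4 → ℝ =>
        (φ (x + e j) - dirichletField ((sbox (R + 1)).image (fun z => x + z)) φ (x + e j)) -
          (φ x - dirichletField ((sbox (R + 1)).image (fun z => x + z)) φ x)) ν ∧
      ∫ φ, ((φ (x + e j) - dirichletField ((sbox (R + 1)).image (fun z => x + z)) φ (x + e j)) -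
          (φ x - dirichletField ((sbox (R + 1)).image (fun z => x + z)) φ x)) ∂ν = 0 := by
  classical
  set Λ : Finset (Site 4) := (sbox (R + 1)).image (fun z => x + z) with hΛ
  set S : Finset (Site 4) := (sbox (R + 2)).image (fun z => x + z) with hS
  have hbdS : outerBoundary (zdGraph 4) Λ ⊆ S := outerBoundary_image_sbox_subset (R + 1) x
  have hxΛ : x ∈ Λ := by have h := add_mem_image_sbox x (zero_mem_sbox (R + 1)); rwa [add_zero] at h
  have hxeΛ : x + e j ∈ Λ := add_mem_image_sbox x (e_mem_sbox (by omega) j)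
  have ha_lin : (fun φ : Site 4 → ℝ => (φ (x + e j) - dirichletField Λ φ (x + e j)) - (φ x - dirichletField Λ φ x)) =
      fun φ => ∑ w' ∈ S, (Literature.Probability.LatticeModels.poissonKernel Λ (x + e j) w' -
        Literature.Probability.LatticeModels.poissonKernel Λ x w') * φ w' := by
    funext φ
    rw [sub_dirichletField_eq_sum hbdS φ hxeΛ, sub_dirichletField_eq_sum hbdS φ hxΛ, ← Finset.sum_sub_distrib]
    exact Finset.sum_congr rfl fun w' _ => by ring
  rw [ha_lin]
  exact ⟨hasGaussianLaw_linStat hν S _, integral_linStat hν S _⟩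

/-- **The variance of the exterior response is exactly `2(∫a²)²`**: `∫ |a² − ∫a²|² dν = 2 (∫ a² dν)²`. [cite: Janson1997, Rem. 1.30] -/
theorem gff_exteriorResponse_sq_eq (hν : IsDiscreteGFF ν (coordProc 4)) (R : ℕ) (j : Fin 4) (x : Site 4) :
    ∫ φ, |((φ (x + e j) - dirichletField ((sbox (R + 1)).image (fun z => x + z)) φ (x + e j)) -
            (φ x - dirichletField ((sbox (R + 1)).image (fun z => x + z)) φ x)) ^ 2 -
          ∫ φ', ((φ' (x + e j) - dirichletField ((sbox (R + 1)).image (fun z => x + z)) φ' (x + e j)) -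
            (φ' x - dirichletField ((sbox (R + 1)).image (fun z => x + z)) φ' x)) ^ 2 ∂ν| ^ 2 ∂ν =
      2 * (∫ φ, ((φ (x + e j) - dirichletField ((sbox (R + 1)).image (fun z => x + z)) φ (x + e j)) -
            (φ x - dirichletField ((sbox (R + 1)).image (fun z => x + z)) φ x)) ^ 2 ∂ν) ^ 2 := by
  obtain ⟨hG, h0⟩ := hasGaussianLaw_centreGradient hν R j x
  exact integral_wickSq_sq_eq hG h0

/-- **V (VarianceBoundaryLaw) in the free field, rate `(C/R⁴)²`**: there is `C ≥ 0` with `∫ |a² − ∫a²|² dν ≤ (C/R⁴)²` for all `R ≥ 1`, all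
directions `j` and centres `x` (`C = 2v`: `2s² ≤ (2v/R⁴)²` from `s ≤ v/R⁴`).  Unconditional: no floors, no sub-onset window. [folklore] -/
theorem gff_varianceBoundaryLaw (hν : IsDiscreteGFF ν (coordProc 4)) :
    ∃ C : ℝ, 0 ≤ C ∧ ∀ (R : ℕ), 1 ≤ R → ∀ (j : Fin 4) (x : Site 4),
      ∫ φ, |((φ (x + e j) - dirichletField ((sbox (R + 1)).image (fun z => x + z)) φ (x + e j)) -
              (φ x - dirichletField ((sbox (R + 1)).image (fun z => x + z)) φ x)) ^ 2 -
            ∫ φ', ((φ' (x + e j) - dirichletField ((sbox (R + 1)).image (fun z => x + z)) φ' (x + e j)) -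
              (φ' x - dirichletField ((sbox (R + 1)).image (fun z => x + z)) φ' x)) ^ 2 ∂ν| ^ 2 ∂ν ≤
        (C / (R : ℝ) ^ 4) ^ 2 := by
  obtain ⟨v, hv0, hv⟩ := gff_integral_centreGradient_sq_le hν
  refine ⟨2 * v, by positivity, fun R hR j x => ?_⟩
  rw [gff_exteriorResponse_sq_eq hν R j x]
  have hsv := hv R hR j x
  have h2 := pow_le_pow_left₀ (integral_nonneg fun _ => sq_nonneg _) hsv 2
  have h4 : (2 * v / (R : ℝ) ^ 4) ^ 2 = 4 * (v / (R : ℝ) ^ 4) ^ 2 := by ring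
  rw [h4]
  nlinarith [h2, sq_nonneg (v / (R : ℝ) ^ 4)]

/-- **V is sharp in the free field**: the rate `R⁻⁸` of `∫|a² − ∫a²|² dν = 2(∫a²)²` is attained — `(c/R⁴)² ≤ ∫ |a² − ∫a²|² dν` for all `R ≥ R₀`
(tree: `gff_integral_centreGradient_sq_ge`, `∫a² ≥ c/R⁴`). [cite: Lawler1991, Theorem 1.5.5] -/
theorem gff_varianceBoundaryLaw_sharp (hν : IsDiscreteGFF ν (coordProc 4)) :
    ∃ c : ℝ, 0 < c ∧ ∃ R₀ : ℕ, ∀ (R : ℕ), R₀ ≤ R → 1 ≤ R → ∀ (j : Fin 4) (x : Site 4),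
      (c / (R : ℝ) ^ 4) ^ 2 ≤
        ∫ φ, |((φ (x + e j) - dirichletField ((sbox (R + 1)).image (fun z => x + z)) φ (x + e j)) -
              (φ x - dirichletField ((sbox (R + 1)).image (fun z => x + z)) φ x)) ^ 2 -
            ∫ φ', ((φ' (x + e j) - dirichletField ((sbox (R + 1)).image (fun z => x + z)) φ' (x + e j)) -
              (φ' x - dirichletField ((sbox (R + 1)).image (fun z => x + z)) φ' x)) ^ 2 ∂ν| ^ 2 ∂ν := by
  obtain ⟨c, hc0, R₀, hc⟩ := gff_integral_centreGradient_sq_ge hν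
  refine ⟨c, hc0, R₀, fun R hR0 hR j x => ?_⟩
  rw [gff_exteriorResponse_sq_eq hν R j x]
  have h := hc R hR0 hR j x
  have hc' : 0 ≤ c / (R : ℝ) ^ 4 := by positivity
  have h2 := pow_le_pow_left₀ hc' h 2
  nlinarith [h2, sq_nonneg (c / (R : ℝ) ^ 4)]

/-- **M (MomentComparability) in the free field, `κ = 1`**: `(∫ |a² − ∫a²|^p dν)² ≤ (6·p)^{2p} (∫ |a² − ∫a²|² dν)^p` for every `p ≥ 1`, every
`R`, `j`, `x` — reverse Hölder for the exterior response with linear growth in `p` (second Wiener chaos). [cite: Janson1997, Thm. 5.10] -/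
theorem gff_momentComparability (hν : IsDiscreteGFF ν (coordProc 4)) (R : ℕ) (j : Fin 4) (x : Site 4) {p : ℕ} (hp : 1 ≤ p) :
    (∫ φ, |((φ (x + e j) - dirichletField ((sbox (R + 1)).image (fun z => x + z)) φ (x + e j)) -
              (φ x - dirichletField ((sbox (R + 1)).image (fun z => x + z)) φ x)) ^ 2 -
            ∫ φ', ((φ' (x + e j) - dirichletField ((sbox (R + 1)).image (fun z => x + z)) φ' (x + e j)) -
              (φ' x - dirichletField ((sbox (R + 1)).image (fun z => x + z)) φ' x)) ^ 2 ∂ν| ^ p ∂ν) ^ 2 ≤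
      (6 * (p : ℝ)) ^ (2 * p) *
        (∫ φ, |((φ (x + e j) - dirichletField ((sbox (R + 1)).image (fun z => x + z)) φ (x + e j)) -
              (φ x - dirichletField ((sbox (R + 1)).image (fun z => x + z)) φ x)) ^ 2 -
            ∫ φ', ((φ' (x + e j) - dirichletField ((sbox (R + 1)).image (fun z => x + z)) φ' (x + e j)) -
              (φ' x - dirichletField ((sbox (R + 1)).image (fun z => x + z)) φ' x)) ^ 2 ∂ν| ^ 2 ∂ν) ^ p := by
  obtain ⟨hG, h0⟩ := hasGaussianLaw_centreGradient hν R j x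
  exact wickSq_momentComparability hG h0 hp

/-- **K1 (AnnealedBoundaryLaw) in the free field, `κ = 1`**: there is `C ≥ 0` with `∫ |a² − ∫a²|^p dν ≤ (C·p/R⁴)^p` for all `R ≥ 1`, `j`, `x`,
`p ≥ 1` (`C = 8v`). [cite: Janson1997, Thm. 5.10] -/
theorem gff_annealedBoundaryLaw (hν : IsDiscreteGFF ν (coordProc 4)) :
    ∃ C : ℝ, 0 ≤ C ∧ ∀ (R : ℕ), 1 ≤ R → ∀ (j : Fin 4) (x : Site 4) (p : ℕ), 1 ≤ p →
      ∫ φ, |((φ (x + e j) - dirichletField ((sbox (R + 1)).image (fun z => x + z)) φ (x + e j)) -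
              (φ x - dirichletField ((sbox (R + 1)).image (fun z => x + z)) φ x)) ^ 2 -
            ∫ φ', ((φ' (x + e j) - dirichletField ((sbox (R + 1)).image (fun z => x + z)) φ' (x + e j)) -
              (φ' x - dirichletField ((sbox (R + 1)).image (fun z => x + z)) φ' x)) ^ 2 ∂ν| ^ p ∂ν ≤
        (C * p / (R : ℝ) ^ 4) ^ p := by
  obtain ⟨v, hv0, hv⟩ := gff_integral_centreGradient_sq_le hν
  refine ⟨8 * v, by positivity, fun R hR j x p hp => ?_⟩
  obtain ⟨hG, h0⟩ := hasGaussianLaw_centreGradient hν R j x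
  have hK := integral_wickSq_abs_pow_le hG h0 hp
  beta_reduce at hK
  have hsv := hv R hR j x
  refine hK.trans (pow_le_pow_left₀ (mul_nonneg (by positivity) (integral_nonneg fun _ => sq_nonneg _)) ?_ p)
  calc 8 * (p : ℝ) * _ ≤ 8 * (p : ℝ) * (v / (R : ℝ) ^ 4) := mul_le_mul_of_nonneg_left hsv (by positivity)
    _ = 8 * v * p / (R : ℝ) ^ 4 := by ring

end GFF

/-! ## §4 The same laws in conditional-expectation (`kerE`) form -/

section CondExp

variable {ν : Measure (Site 4 → ℝ)}

/-- **Dictionary `kerE ↔ harmonic extension`**: for the GFF of `ℤ⁴`, the cube `Λ = x + sbox(R+1)` and a direction `j`,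
`ν[(φ_{x+e_j} − φ_x)² | σ(φ_w : w ∉ Λ)] − ∫(φ_{x+e_j} − φ_x)² dν = a² − ∫a² dν`  a.e., `a = ∇_j(φ − ψ^Λ)(x)` (the Dirichlet variances cancel
against the means; tree `condExp_gradient_sq_exterior`). [cite: FriedliVelenik2017, Ch. 8 Thm. 8.21] -/
theorem condExp_sq_gradient_sub_mean_ae_eq (hν : IsDiscreteGFF ν (coordProc 4)) (R : ℕ) (j : Fin 4) (x : Site 4) :
    ∀ᵐ φ ∂ν,
      (ν[fun φ' : Site 4 → ℝ => (φ' (x + e j) - φ' x) ^ 2 |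
          MeasurableSpace.comap (fun (φ' : Site 4 → ℝ) (w : {w : Site 4 // w ∉ (sbox (R + 1)).image (fun z => x + z)}) => φ' w)
            inferInstance]) φ - ∫ φ', (φ' (x + e j) - φ' x) ^ 2 ∂ν =
        ((φ (x + e j) - dirichletField ((sbox (R + 1)).image (fun z => x + z)) φ (x + e j)) -
            (φ x - dirichletField ((sbox (R + 1)).image (fun z => x + z)) φ x)) ^ 2 -
          ∫ φ', ((φ' (x + e j) - dirichletField ((sbox (R + 1)).image (fun z => x + z)) φ' (x + e j)) -
            (φ' x - dirichletField ((sbox (R + 1)).image (fun z => x + z)) φ' x)) ^ 2 ∂ν := by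
  classical
  have hP := hν.1.isProbabilityMeasure
  set Λ : Finset (Site 4) := (sbox (R + 1)).image (fun z => x + z) with hΛ
  have hx : x ∈ Λ := by have h := add_mem_image_sbox x (zero_mem_sbox (R + 1)); rwa [add_zero] at h
  have hxe : x + Pi.single j 1 ∈ Λ := add_mem_image_sbox x (e_mem_sbox (by omega) j)
  have hext_m : Measurable (fun (φ' : Site 4 → ℝ) (w : {w : Site 4 // w ∉ Λ}) => φ' w) :=
    measurable_pi_lambda _ fun w => measurable_pi_apply _
  have hkey := condExp_gradient_sq_exterior hν (by norm_num) Λ hx hxe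
  simp only [← e_def] at hkey
  have hψ2 : ∀ y : Site 4, MemLp (fun φ : Site 4 → ℝ => dirichletField Λ φ y) 2 ν := fun y =>
    ((hν.isGaussianProcess_dirichletField Λ).hasGaussianLaw_eval y).memLp_two
  have hQi : Integrable (fun φ : Site 4 → ℝ => ((φ (x + e j) - dirichletField Λ φ (x + e j)) -
      (φ x - dirichletField Λ φ x)) ^ 2) ν :=
    (((hν.memLp_coord _).sub (hψ2 _)).sub ((hν.memLp_coord _).sub (hψ2 _))).integrable_sq
  have hmean : ∫ φ', (φ' (x + e j) - φ' x) ^ 2 ∂ν =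
      ∫ φ', ((φ' (x + e j) - dirichletField Λ φ' (x + e j)) - (φ' x - dirichletField Λ φ' x)) ^ 2 ∂ν +
        ∫ φ', (dirichletField Λ φ' (x + e j) - dirichletField Λ φ' x) ^ 2 ∂ν := by
    rw [← integral_condExp hext_m.comap_le (f := fun φ' : Site 4 → ℝ => (φ' (x + e j) - φ' x) ^ 2),
      integral_congr_ae hkey, integral_add hQi (integrable_const _), integral_const, probReal_univ, one_smul]
  filter_upwards [hkey] with φ hφ
  rw [hφ, hmean]
  ring

/-- The `p`-th absolute moments of the centred conditional expectation and of `a² − ∫a²` agree (integrals of a.e.-equal functions). [folklore] -/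
theorem integral_abs_condExp_sub_mean_pow_eq (hν : IsDiscreteGFF ν (coordProc 4)) (R : ℕ) (j : Fin 4) (x : Site 4) (p : ℕ) :
    ∫ φ, |(ν[fun φ' : Site 4 → ℝ => (φ' (x + e j) - φ' x) ^ 2 |
            MeasurableSpace.comap (fun (φ' : Site 4 → ℝ) (w : {w : Site 4 // w ∉ (sbox (R + 1)).image (fun z => x + z)}) => φ' w)
              inferInstance]) φ - ∫ φ', (φ' (x + e j) - φ' x) ^ 2 ∂ν| ^ p ∂ν =
      ∫ φ, |((φ (x + e j) - dirichletField ((sbox (R + 1)).image (fun z => x + z)) φ (x + e j)) -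
              (φ x - dirichletField ((sbox (R + 1)).image (fun z => x + z)) φ x)) ^ 2 -
            ∫ φ', ((φ' (x + e j) - dirichletField ((sbox (R + 1)).image (fun z => x + z)) φ' (x + e j)) -
              (φ' x - dirichletField ((sbox (R + 1)).image (fun z => x + z)) φ' x)) ^ 2 ∂ν| ^ p ∂ν :=
  integral_congr_ae (by
    filter_upwards [condExp_sq_gradient_sub_mean_ae_eq hν R j x] with φ hφ
    rw [hφ])

/-- **V (VarianceBoundaryLaw) in the free field, `kerE` form**: `∫ |ν[(∇_jφ(x))² | exterior of Λ] − ∫(∇_jφ(x))²|² dν ≤ (C/R⁴)²` for all `R ≥ 1`,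
`j`, `x` — the free-field instance of the CONCLUSION of `TypicalExteriorCeilings.VarianceBoundaryLaw` (stmt-25920) with the torus Wilson state
replaced by the lattice GFF of `ℤ⁴` (floors prefix dropped: `Q3 ≡ 0` in Gaussian models). [cite: FriedliVelenik2017, Ch. 8 Thm. 8.21] -/
theorem gff_varianceBoundaryLaw_condExp (hν : IsDiscreteGFF ν (coordProc 4)) :
    ∃ C : ℝ, 0 ≤ C ∧ ∀ (R : ℕ), 1 ≤ R → ∀ (j : Fin 4) (x : Site 4),
      ∫ φ, |(ν[fun φ' : Site 4 → ℝ => (φ' (x + e j) - φ' x) ^ 2 |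
              MeasurableSpace.comap (fun (φ' : Site 4 → ℝ) (w : {w : Site 4 // w ∉ (sbox (R + 1)).image (fun z => x + z)}) => φ' w)
                inferInstance]) φ - ∫ φ', (φ' (x + e j) - φ' x) ^ 2 ∂ν| ^ 2 ∂ν ≤ (C / (R : ℝ) ^ 4) ^ 2 := by
  obtain ⟨C, hC0, hC⟩ := gff_varianceBoundaryLaw hν
  exact ⟨C, hC0, fun R hR j x => by rw [integral_abs_condExp_sub_mean_pow_eq hν R j x 2]; exact hC R hR j x⟩

/-- **M (MomentComparability) in the free field, `kerE` form, `κ = 1`**: `(∫|Z|^p dν)² ≤ (6p)^{2p} (∫|Z|² dν)^p`,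
`Z = ν[(∇_jφ(x))² | exterior of Λ] − ∫(∇_jφ(x))² dν`, all `p ≥ 1`, `R`, `j`, `x` — the free-field instance of the CONCLUSION of
`TypicalExteriorCeilings.MomentComparability` (stmt-25921) with `κ = 1`. [cite: Janson1997, Thm. 5.10] -/
theorem gff_momentComparability_condExp (hν : IsDiscreteGFF ν (coordProc 4)) (R : ℕ) (j : Fin 4) (x : Site 4) {p : ℕ}
    (hp : 1 ≤ p) :
    (∫ φ, |(ν[fun φ' : Site 4 → ℝ => (φ' (x + e j) - φ' x) ^ 2 |
              MeasurableSpace.comap (fun (φ' : Site 4 → ℝ) (w : {w : Site 4 // w ∉ (sbox (R + 1)).image (fun z => x + z)}) => φ' w)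
                inferInstance]) φ - ∫ φ', (φ' (x + e j) - φ' x) ^ 2 ∂ν| ^ p ∂ν) ^ 2 ≤
      (6 * (p : ℝ)) ^ (2 * p) *
        (∫ φ, |(ν[fun φ' : Site 4 → ℝ => (φ' (x + e j) - φ' x) ^ 2 |
              MeasurableSpace.comap (fun (φ' : Site 4 → ℝ) (w : {w : Site 4 // w ∉ (sbox (R + 1)).image (fun z => x + z)}) => φ' w)
                inferInstance]) φ - ∫ φ', (φ' (x + e j) - φ' x) ^ 2 ∂ν| ^ 2 ∂ν) ^ p := by
  rw [integral_abs_condExp_sub_mean_pow_eq hν R j x p, integral_abs_condExp_sub_mean_pow_eq hν R j x 2]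
  exact gff_momentComparability hν R j x hp

/-- **K1 (AnnealedBoundaryLaw) in the free field, `kerE` form, `κ = 1`**: `∫ |Z|^p dν ≤ (C·p/R⁴)^p` for all `R ≥ 1`, `j`, `x`, `p ≥ 1` — the
free-field instance of the CONCLUSION of `TypicalExteriorCeilings.AnnealedBoundaryLaw` (stmt-25891). [cite: Janson1997, Thm. 5.10] -/
theorem gff_annealedBoundaryLaw_condExp (hν : IsDiscreteGFF ν (coordProc 4)) :
    ∃ C : ℝ, 0 ≤ C ∧ ∀ (R : ℕ), 1 ≤ R → ∀ (j : Fin 4) (x : Site 4) (p : ℕ), 1 ≤ p →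
      ∫ φ, |(ν[fun φ' : Site 4 → ℝ => (φ' (x + e j) - φ' x) ^ 2 |
              MeasurableSpace.comap (fun (φ' : Site 4 → ℝ) (w : {w : Site 4 // w ∉ (sbox (R + 1)).image (fun z => x + z)}) => φ' w)
                inferInstance]) φ - ∫ φ', (φ' (x + e j) - φ' x) ^ 2 ∂ν| ^ p ∂ν ≤ (C * p / (R : ℝ) ^ 4) ^ p := by
  obtain ⟨C, hC0, hC⟩ := gff_annealedBoundaryLaw hν
  exact ⟨C, hC0, fun R hR j x p hp => by
    rw [integral_abs_condExp_sub_mean_pow_eq hν R j x p]; exact hC R hR j x p hp⟩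

end CondExp

/-! ## §5 Non-vacuity: the lattice GFF of `ℤ⁴` exists on the canonical space -/

section Existence

open Literature.MathematicalPhysics.QuantumFieldTheory (IsPosSemidefKernel covGram covGram_apply gaussianFieldOfKernel
  isProbabilityMeasure_gaussianFieldOfKernel isGaussianProcess_eval_gaussianFieldOfKernel integral_eval_gaussianFieldOfKernel
  covariance_eval_gaussianFieldOfKernel sum_sum_mul_mul_half_latticeGreen_nonneg)
open scoped Matrix

/-- `K(x, y) = latticeGreen(x − y)/2` is a positive semidefinite kernel on `ℤ⁴` (Fourier positivity of the Green function, tree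
`sum_sum_mul_mul_half_latticeGreen_nonneg`; symmetry from evenness). [folklore] -/
theorem isPosSemidefKernel_halfLatticeGreen_four :
    IsPosSemidefKernel (fun x y : Site 4 => latticeGreen (x - y) / 2) := by
  intro I
  refine Matrix.PosSemidef.of_dotProduct_mulVec_nonneg (Matrix.IsHermitian.ext fun s t => ?_) fun c => ?_
  · simp only [covGram_apply, star_trivial]
    rw [show ((t : Site 4) - (s : Site 4) : Site 4) = -((s : Site 4) - (t : Site 4)) by abel,
      Literature.Probability.LatticeModels.latticeGreen_neg]
  · rw [star_trivial]
    have h := sum_sum_mul_mul_half_latticeGreen_nonneg (d := 4) (by norm_num) I (fun s : I => (s : Site 4)) c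
    have expand : c ⬝ᵥ (covGram (fun x y : Site 4 => latticeGreen (x - y) / 2) I *ᵥ c) =
        ∑ j : I, ∑ j' : I, c j * c j' * (latticeGreen ((j : Site 4) - (j' : Site 4)) / 2) := by
      simp only [dotProduct, Matrix.mulVec, covGram_apply, Finset.mul_sum]
      refine Finset.sum_congr rfl fun s _ => Finset.sum_congr rfl fun t _ => ?_
      ring
    rw [expand]
    exact h

/-- **The discrete GFF of `ℤ⁴` exists**: the Gaussian field of the kernel `latticeGreen(x − y)/2` on the canonical space `ℤ⁴ → ℝ` makes the
coordinate process a discrete GFF (`IsDiscreteGFF · (coordProc 4)`), so §3–§4 are not vacuous. [cite: Kallenberg2002, Lemma 13.1 / Thm. 6.16] -/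
theorem exists_isDiscreteGFF_four : ∃ ν : Measure (Site 4 → ℝ), IsDiscreteGFF ν (coordProc 4) := by
  set K : Site 4 → Site 4 → ℝ := fun x y => latticeGreen (x - y) / 2 with hKdef
  have hK : IsPosSemidefKernel K := isPosSemidefKernel_halfLatticeGreen_four
  haveI := isProbabilityMeasure_gaussianFieldOfKernel hK
  refine ⟨gaussianFieldOfKernel K, isGaussianProcess_eval_gaussianFieldOfKernel hK, integral_eval_gaussianFieldOfKernel hK,
    fun x y => ?_⟩
  have h2 : ∀ s : Site 4, MemLp (fun ω : Site 4 → ℝ => ω s) 2 (gaussianFieldOfKernel K) := fun s =>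
    ((isGaussianProcess_eval_gaussianFieldOfKernel hK).hasGaussianLaw_eval s).memLp (by norm_num)
  have h := covariance_eq_sub (μ := gaussianFieldOfKernel K) (h2 x) (h2 y)
  rw [covariance_eval_gaussianFieldOfKernel hK, integral_eval_gaussianFieldOfKernel hK x, zero_mul, sub_zero] at h
  have h' : ∫ ω, ω x * ω y ∂gaussianFieldOfKernel K = K x y := by
    rw [h]
    rfl
  exact h'

end Existence

/-! ## §6 The rung in the literal functional shape of the cruxes (`C·p^κ` with `κ = 1` exhibited; `kerE` form) -/

section RungShape

variable {ν : Measure (Site 4 → ℝ)}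

/-- **RUNG α — M-part in the shape of `TypicalExteriorCeilings.MomentComparability` (stmt-25921)**: for the lattice GFF of `ℤ⁴` there are
`C ≥ 0` and an exponent `κ` WITH `κ = 1` such that `(∫|Z|^p dν)² ≤ (C·p^κ)^{2p} (∫|Z|² dν)^p` for all `R`, `j`, `x`, `p ≥ 1`,
`Z = ν[(∇_jφ(x))² | σ(φ_w : w ∉ x + sbox(R+1))] − ∫(∇_jφ(x))² dν` — the crux's conclusion with (torus Wilson state, `kerE`, `torusE`) ↦
(GFF, conditional expectation, `∫·dν`) and the floors prefix dropped.  Not the crux; not uniform in anything non-Gaussian. [cite: Janson1997, Thm. 5.10] -/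
theorem rung_momentComparability_freeField (hν : IsDiscreteGFF ν (coordProc 4)) :
    ∃ C κ : ℝ, 0 ≤ C ∧ 0 ≤ κ ∧ κ = 1 ∧ ∀ (R : ℕ) (j : Fin 4) (x : Site 4) (p : ℕ), 1 ≤ p →
      (∫ φ, |(ν[fun φ' : Site 4 → ℝ => (φ' (x + e j) - φ' x) ^ 2 |
              MeasurableSpace.comap (fun (φ' : Site 4 → ℝ) (w : {w : Site 4 // w ∉ (sbox (R + 1)).image (fun z => x + z)}) => φ' w)
                inferInstance]) φ - ∫ φ', (φ' (x + e j) - φ' x) ^ 2 ∂ν| ^ p ∂ν) ^ 2 ≤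
        (C * (p : ℝ) ^ κ) ^ (2 * p) *
          (∫ φ, |(ν[fun φ' : Site 4 → ℝ => (φ' (x + e j) - φ' x) ^ 2 |
              MeasurableSpace.comap (fun (φ' : Site 4 → ℝ) (w : {w : Site 4 // w ∉ (sbox (R + 1)).image (fun z => x + z)}) => φ' w)
                inferInstance]) φ - ∫ φ', (φ' (x + e j) - φ' x) ^ 2 ∂ν| ^ 2 ∂ν) ^ p :=
  ⟨6, 1, by norm_num, zero_le_one, rfl, fun R j x p hp => by
    rw [Real.rpow_one]; exact gff_momentComparability_condExp hν R j x hp⟩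

/-- **RUNG α — K1-shape** (`TypicalExteriorCeilings.AnnealedBoundaryLaw`, stmt-25891, free-field instance of the conclusion): `C ≥ 0`, `κ = 1`,
`∫|Z|^p dν ≤ (C·p^κ/R⁴)^p` for all `R ≥ 1`, `j`, `x`, `p ≥ 1`. [cite: Janson1997, Thm. 5.10] -/
theorem rung_annealedBoundaryLaw_freeField (hν : IsDiscreteGFF ν (coordProc 4)) :
    ∃ C κ : ℝ, 0 ≤ C ∧ 0 ≤ κ ∧ κ = 1 ∧ ∀ (R : ℕ), 1 ≤ R → ∀ (j : Fin 4) (x : Site 4) (p : ℕ), 1 ≤ p →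
      ∫ φ, |(ν[fun φ' : Site 4 → ℝ => (φ' (x + e j) - φ' x) ^ 2 |
              MeasurableSpace.comap (fun (φ' : Site 4 → ℝ) (w : {w : Site 4 // w ∉ (sbox (R + 1)).image (fun z => x + z)}) => φ' w)
                inferInstance]) φ - ∫ φ', (φ' (x + e j) - φ' x) ^ 2 ∂ν| ^ p ∂ν ≤ (C * (p : ℝ) ^ κ / (R : ℝ) ^ 4) ^ p := by
  obtain ⟨C, hC0, hC⟩ := gff_annealedBoundaryLaw_condExp hν
  exact ⟨C, 1, hC0, zero_le_one, rfl, fun R hR j x p hp => by rw [Real.rpow_one]; exact hC R hR j x p hp⟩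

/-- **RUNG α — V-shape** (`TypicalExteriorCeilings.VarianceBoundaryLaw`, stmt-25920, free-field instance of the conclusion) together with its
SHARPNESS: `∫|Z|² dν ≤ (C/R⁴)²` for all `R ≥ 1` and `(c/R⁴)² ≤ ∫|Z|² dν` for all `R ≥ R₀` (`c > 0`) — the rate of V is the free-field rate.
[cite: FriedliVelenik2017, Ch. 8 Thm. 8.21] [cite: Lawler1991, Theorem 1.5.5] -/
theorem rung_varianceBoundaryLaw_freeField (hν : IsDiscreteGFF ν (coordProc 4)) :
    (∃ C : ℝ, 0 ≤ C ∧ ∀ (R : ℕ), 1 ≤ R → ∀ (j : Fin 4) (x : Site 4),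
      ∫ φ, |(ν[fun φ' : Site 4 → ℝ => (φ' (x + e j) - φ' x) ^ 2 |
              MeasurableSpace.comap (fun (φ' : Site 4 → ℝ) (w : {w : Site 4 // w ∉ (sbox (R + 1)).image (fun z => x + z)}) => φ' w)
                inferInstance]) φ - ∫ φ', (φ' (x + e j) - φ' x) ^ 2 ∂ν| ^ 2 ∂ν ≤ (C / (R : ℝ) ^ 4) ^ 2) ∧
    (∃ c : ℝ, 0 < c ∧ ∃ R₀ : ℕ, ∀ (R : ℕ), R₀ ≤ R → 1 ≤ R → ∀ (j : Fin 4) (x : Site 4),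
      (c / (R : ℝ) ^ 4) ^ 2 ≤
        ∫ φ, |(ν[fun φ' : Site 4 → ℝ => (φ' (x + e j) - φ' x) ^ 2 |
              MeasurableSpace.comap (fun (φ' : Site 4 → ℝ) (w : {w : Site 4 // w ∉ (sbox (R + 1)).image (fun z => x + z)}) => φ' w)
                inferInstance]) φ - ∫ φ', (φ' (x + e j) - φ' x) ^ 2 ∂ν| ^ 2 ∂ν) := by
  refine ⟨gff_varianceBoundaryLaw_condExp hν, ?_⟩
  obtain ⟨c, hc0, R₀, hc⟩ := gff_varianceBoundaryLaw_sharp hν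
  exact ⟨c, hc0, R₀, fun R hR0 hR j x => by rw [integral_abs_condExp_sub_mean_pow_eq hν R j x 2]; exact hc R hR0 hR j x⟩

end RungShape

end Summit.QuantumFields.YangMills.Cruxes.AnnealedBoundaryLaw.GaussianRung

end
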